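import Mathlib.RingTheory.Flat.TorsionFree
import Mathlib.RingTheory.Flat.Stability
import Mathlib.RingTheory.FinitePresentation
import Mathlib.RingTheory.Localization.AtPrime.Basic
import Mathlib.RingTheory.Valuation.ValuationRing
import HarnessLib

/-!
# Two flatness facts: the "critère de platitude par fibres" and Nagata's finite presentation of flat algebras over valuation rings

Topic: `Literature/RingTheory/Flat`. Two standard results of commutative algebra that Mathlib
(v4.32) lacks, vendored as named facts in the affine form in which they are used to study
models of finite type over a valuation ring (e.g. in the algebraic treatment of Temkin 2013,
Lemma 3.3.2, `Literature/AlgebraicGeometry/Resolution/InseparableLocalUniformizationDecompletion.lean`):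

* `Stacks05UV` — NAMED FACT, the **fibrewise criterion of flatness** in the non-Noetherian form
  of the Stacks Project (Tag 05UV, a consequence of Tag 00R7 "Critère de platitude par fibres";
  EGA IV₃ 11.3.10 in the Noetherian case): over a local ring `(R, 𝔪)`, a finitely presented flat
  `R`-algebra `B′` receiving an `R`-algebra map from a finite type `R`-algebra `B` is flat over `B`
  at every prime of `B′` above `𝔪` as soon as the closed fibre `B′/𝔪B′` is flat over `B/𝔪B`.
* `Stacks053E` — NAMED FACT, **Nagata's theorem** (Nagata 1966, Thm. 3 = Stacks Project,
  Tag 053E (1)): a flat algebra of finite type over a valuation ring is finitely presented.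
* PROVED corollaries `Stacks053E.finitePresentation_of_isTorsionFree`,
  `Stacks053E.finitePresentation_of_faithfulSMul`: a torsion-free (e.g. a domain containing the
  base, such as a finitely generated subalgebra of a field extension of the fraction field)
  algebra of finite type over a valuation ring is finitely presented — torsion-free modules over
  valuation rings (Bézout domains) are flat, `Module.Flat.flat_iff_torsion_eq_bot_of_isBezout`
  (Stacks Project, Tag 0539).

## Sources

* The Stacks Project, Tag 00R7 (Algebra, Lemma "Critère de platitude par fibres"), Tag 05UV
  (Algebra, the next lemma: "`R → S′` essentially of finite presentation, `R → S` essentially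
  of finite type"), Tag 053E (More on Algebra, Lemma: "Let `A` be a valuation ring. Let `A → B`
  be a ring map of finite type. Let `M` be a finite `B`-module. (1) If `B` is flat over `A`,
  then `B` is a finitely presented `A`-algebra. (2) …"), Tag 0539.
* M. Nagata, *Finitely generated rings over a valuation ring*, J. Math. Kyoto Univ. 5 (1966)
  163–169, Thm. 3.
* A. Grothendieck, EGA IV₃, Publ. Math. IHÉS 28 (1966), Thm. 11.3.10.

## Rendering notes

* Tag 05UV is printed for local homomorphisms of local rings `R → S → S′` with `R → S′`
  essentially of finite presentation, `R → S` essentially of finite type and a finitely presented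
  non-zero `S′`-module `M`, flat over `R`, with `M/𝔪M` flat over `S/𝔪S`; conclusion: `S` is
  essentially of finite presentation and flat over `R`, and `M` is flat over `S`. It is vendored
  in the special case `M = S′`, `S = B_𝔮`, `S′ = B′_{𝔮′}` for algebras `B` (finite type),
  `B′` (finitely presented) over `R` and a prime `𝔮′ ⊂ B′` above `𝔪` (`𝔮 = 𝔮′ ∩ B`), with the
  fibre hypothesis in the (stronger) global form "`(B/𝔪B) ⊗_B B′ = B′/𝔪B′` is flat over `B/𝔪B`"
  and the flatness of `M = B′_{𝔮′}` over `R` in the (stronger) global form "`B′` flat over `R`";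
  the conclusion "`B′_{𝔮′}` flat over `B_𝔮`" is stated equivalently as "`B′_{𝔮′}` flat over `B`".
-/

namespace Literature.RingTheory.Flat

universe u

open IsLocalRing TensorProduct

/-- NAMED FACT — **critère de platitude par fibres, finitely presented over finite type**
(The Stacks Project, Tag 05UV: "Let `R`, `S`, `S′` be local rings and let `R → S → S′` be local
ring homomorphisms. Let `M` be an `S′`-module. Let `𝔪 ⊂ R` be the maximal ideal. Assume (1)
`R → S′` is essentially of finite presentation, (2) `R → S` is essentially of finite type, (3)
`M` is of finite presentation over `S′`, (4) `M` is not zero, (5) `M/𝔪M` is a flat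
`S/𝔪S`-module, and (6) `M` is a flat `R`-module. Then `S` is essentially of finite presentation
and flat over `R` and `M` is a flat `S`-module."; cf. Tag 00R7 and EGA IV₃ 11.3.10), vendored
for `M = S′` and algebras: `(R, 𝔪)` a local ring, `B` an `R`-algebra of finite type, `B′` a
finitely presented `R`-algebra which is flat over `R`, `B → B′` an `R`-algebra map, `𝔮′ ⊂ B′` a
prime containing `𝔪B′`; if `B′/𝔪B′ = (B/𝔪B) ⊗_B B′` is flat over `B/𝔪B`, then `B′_{𝔮′}` is flat
over `B` (equivalently over `B_{𝔮′ ∩ B}`; apply the printed lemma to `R → B_{𝔮′∩B} → B′_{𝔮′}`,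
`M = B′_{𝔮′}`). Users take `(h : Stacks05UV)`. [cite: StacksProject, Tag 05UV] -/
def Stacks05UV : Prop :=
  ∀ (R B B' : Type u) [CommRing R] [IsLocalRing R] [CommRing B] [CommRing B'] [Algebra R B]
    [Algebra R B'] [Algebra B B'] [IsScalarTower R B B'],
    Algebra.FiniteType R B → Algebra.FinitePresentation R B' → Module.Flat R B' →
    Module.Flat (B ⧸ (maximalIdeal R).map (algebraMap R B))
      ((B ⧸ (maximalIdeal R).map (algebraMap R B)) ⊗[B] B') →
  ∀ (q' : Ideal B') [q'.IsPrime], (maximalIdeal R).map (algebraMap R B') ≤ q' →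
    Module.Flat B (Localization.AtPrime q')

/-- NAMED FACT — **Nagata's theorem: a flat algebra of finite type over a valuation ring is
finitely presented** (Nagata 1966, Thm. 3; The Stacks Project, Tag 053E: "Let `A` be a
valuation ring. Let `A → B` be a ring map of finite type. Let `M` be a finite `B`-module. (1) If
`B` is flat over `A`, then `B` is a finitely presented `A`-algebra. (2) If `M` is flat as an
`A`-module, then `M` is finitely presented as a `B`-module."), part (1). Users take
`(h : Stacks053E)`. [cite: StacksProject, Tag 053E (1)] -/
def Stacks053E : Prop :=
  ∀ (A B : Type u) [CommRing A] [IsDomain A] [ValuationRing A] [CommRing B] [Algebra A B],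
    Algebra.FiniteType A B → Module.Flat A B → Algebra.FinitePresentation A B

/-- Over a valuation ring a torsion-free algebra of finite type — e.g. a finitely generated
subalgebra of a field extension of the fraction field — is finitely presented: torsion-free
modules over a valuation ring are flat (Stacks Project, Tag 0539, in Mathlib as
`Module.Flat.flat_iff_torsion_eq_bot_of_isBezout`), then Nagata's theorem `Stacks053E`. PROVED
from the fact. [cite: StacksProject, Tag 053E (1)] -/
theorem Stacks053E.finitePresentation_of_isTorsionFree (h : Stacks053E.{u}) (A B : Type u)
    [CommRing A] [IsDomain A] [ValuationRing A] [CommRing B] [Algebra A B]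
    [Module.IsTorsionFree A B] [Algebra.FiniteType A B] : Algebra.FinitePresentation A B := by
  have hflat : Module.Flat A B :=
    Module.Flat.flat_iff_torsion_eq_bot_of_isBezout.mpr
      (Submodule.isTorsionFree_iff_torsion_eq_bot.mp inferInstance)
  exact h A B inferInstance hflat

/-- In particular a finite type algebra over a valuation ring `A` which is a domain into which
`A` embeds (a finitely generated `A°`-subalgebra of a field extension `K ⊇ Frac A`, an "affine
model") is finitely presented. PROVED from the fact. [cite: StacksProject, Tag 053E (1)] -/
theorem Stacks053E.finitePresentation_of_faithfulSMul (h : Stacks053E.{u}) (A B : Type u)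
    [CommRing A] [IsDomain A] [ValuationRing A] [CommRing B] [IsDomain B] [Algebra A B]
    [FaithfulSMul A B] [Algebra.FiniteType A B] : Algebra.FinitePresentation A B :=
  h.finitePresentation_of_isTorsionFree A B

end Literature.RingTheory.Flat
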